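import Mathlib.Algebra.Lie.OfAssociative
import Mathlib.Data.Matrix.Basis
import Mathlib.Data.Complex.Basic
import Mathlib.Algebra.BigOperators.Fin
import Mathlib.Tactic.LinearCombination
import Mathlib.Tactic.Module
import Mathlib.Tactic.FieldSimp
import HarnessLib

/-!
# Two commuting `𝔤𝔩₂(ℂ)`-actions: the quartic relation of a minimal `U(2)`-type

Topic `Algebra/Lie`; namespace `Literature.Algebra.Lie.GL2Pair`. Pure non-commutative algebra
over `ℂ`, no analysis and no number theory.

Let `A, B : 𝔤𝔩₂(ℂ) →ₗ⁅ℂ⁆ End V` be two Lie algebra actions on a complex vector space `V` which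
commute with each other (`A X ∘ B Y = B Y ∘ A X`); this is an action of
`𝔤𝔩₂(ℂ) ⊗_ℝ ℂ ≅ 𝔤𝔩₂(ℂ) ⊕ 𝔤𝔩₂(ℂ)` (holomorphic and antiholomorphic factor), as on the `K`-finite
vectors of a representation of `GL₂(ℂ)`.  Write `E_ab = Matrix.single a b 1` for the matrix units,
`κ(Y) = A(Y) - B(Yᵀ)` for the complexified "compact" `𝔤𝔩₂ = 𝔲(2)_ℂ` and `P(Y) = A(Y) + B(Yᵀ)` for
the complement, and
`E = κ(E₀₁)`, `F = κ(E₁₀)`, `K₁ = κ(E₀₀)`, `K₂ = κ(E₁₁)`, `P₊ = P(E₀₁)`, `P₋ = P(E₁₀)`,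
`Q₁ = P(E₀₀)`, `Q₂ = P(E₁₁)`, `P₀ = Q₁ - Q₂`.
Assume the centre and the quadratic Casimirs act by scalars:
`A(1) = S_A`, `B(1) = S_B`, `Σ_ab A(E_ab)A(E_ba) = c_A`, `Σ_ab B(E_ab)B(E_ba) = c_B`, and put
`a² := 2c_A + 1 - S_A²`, `a'² := 2c_B + 1 - S_B²`, `δ := a² - a'²`.

* `level_identity` — for a `κ`-highest-weight vector `x` (`E x = 0`, `K₁ x = n₁ x`, `K₂ x = n₂ x`):
  `(n₁ - n₂ + 2) P₀ x = δ x - 2 F P₊ x` (the Casimir identity `C_A - C_B = Q₁K₁ + Q₂K₂ + P₊F + P₋E`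
  evaluated at `x`).
* `quartic_of_minimal` — if `v ≠ 0` is such a vector with weights `(m₁, m₂)`, `j = m₁ - m₂`,
  `j, j+1, j+2, j+3, j+4 ≠ 0`, and the weight-`(m₁-1, m₂+1)` highest-weight component of `P₋ v`
  vanishes, i.e. `P₋ v = (δ/(j(j+2))) F v - (1/((j+1)(j+2))) F² P₊ v` (this holds when the
  `U(2)`-type of `v` is minimal), then `j⁴ - 2(a² + a'²) j² + (a² - a'²)² = 0`, i.e.
  `(j² - (a+a')²)(j² - (a-a')²) = 0`: the highest weight of the minimal `U(2)`-type is `±a ± a'`.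
  This is the algebraic core of the integrality ("pairing") of the Harish-Chandra exponents of the
  two factors of an irreducible admissible representation of `GL₂(ℂ)`.

Method: the commutation relations of the eight operators `A(E_ab)`, `B(E_ab)` are used as a
normal-ordering `simp` set on vectors (`c01_00`, …, `commute_apply`), which proves the commutator table of
`E, F, K, P, Q` and the two Casimir identities `casimir_sub_casimir`, `casimir_add_casimir`
mechanically; the level identity at `v` and at `P₊ v`, the identity `C_A + C_B` at `v`, the
relation `[P₋, P₊] = -(K₁ - K₂)` and the minimality relation are then nine linear equations between
eleven vectors, and an explicit polynomial combination of them (`linear_combination` over the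
`module` normal form) is `(j+2)(4j² + k j² - δ²) • v = 0` with `k = 4(c_A+c_B) - 2m₁² - 2m₂² -
(S_A+S_B)²`, which is the quartic after `m₁ + m₂ = S_A - S_B`.  Everything here is proved; there
are no definitions (the composite operators are local notation).

References: the classification of the irreducible representations of `GL₂(ℂ)` / `SL₂(ℂ)` by a
pair of characters and their minimal `SU(2)`-types, Jacquet–Langlands (1970), Ch. I §6; Knapp
(1986), Ch. II §4; for the Casimir normalisations Knapp (2002), Ch. V §4–5.
-/

attribute [local instance 100] LieRing.ofAssociativeRing

namespace Literature.Algebra.Lie.GL2Pair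

variable {V : Type*} [AddCommGroup V] [Module ℂ V]

local notation "gl₂" => Matrix (Fin 2) (Fin 2) ℂ
local notation "E₀₀" => Matrix.single (0 : Fin 2) (0 : Fin 2) (1 : ℂ)
local notation "E₀₁" => Matrix.single (0 : Fin 2) (1 : Fin 2) (1 : ℂ)
local notation "E₁₀" => Matrix.single (1 : Fin 2) (0 : Fin 2) (1 : ℂ)
local notation "E₁₁" => Matrix.single (1 : Fin 2) (1 : Fin 2) (1 : ℂ)

section OneAction

variable (Φ : gl₂ →ₗ⁅ℂ⁆ Module.End ℂ V)

/-- The commutation relations of the matrix units `E_ab = Matrix.single a b 1` of `𝔤𝔩₂`,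
transported by a Lie homomorphism `Φ : 𝔤𝔩₂(ℂ) → End V` and written on vectors in normal-ordering
form: `Φ(E_ab) Φ(E_cd) x = Φ(E_cd) Φ(E_ab) x + δ_bc Φ(E_ad) x - δ_da Φ(E_cb) x`. [folklore] -/
theorem apply_single_apply_single (a b c d : Fin 2) (x : V) :
    Φ (Matrix.single a b 1) (Φ (Matrix.single c d 1) x) =
      Φ (Matrix.single c d 1) (Φ (Matrix.single a b 1) x) +
        (if b = c then Φ (Matrix.single a d 1) x else 0) -
        (if d = a then Φ (Matrix.single c b 1) x else 0) := by
  have h := LinearMap.congr_fun (Φ.map_lie (Matrix.single a b 1) (Matrix.single c d 1)) x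
  simp only [LieRing.of_associative_ring_bracket, map_sub, LinearMap.sub_apply,
    Module.End.mul_apply] at h
  by_cases hbc : b = c <;> by_cases hda : d = a
  · subst hbc hda
    simp only [Matrix.single_mul_single_same, mul_one, if_true] at h ⊢
    linear_combination (norm := abel) h.symm
  · subst hbc
    simp only [Matrix.single_mul_single_same, mul_one, if_true, hda, if_false,
      Matrix.single_mul_single_of_ne, ne_eq, not_false_eq_true, map_zero,
      LinearMap.zero_apply] at h ⊢
    linear_combination (norm := abel) h.symm
  · subst hda
    simp only [Matrix.single_mul_single_same, mul_one, if_true, hbc, if_false,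
      Matrix.single_mul_single_of_ne, ne_eq, not_false_eq_true, map_zero,
      LinearMap.zero_apply] at h ⊢
    linear_combination (norm := abel) h.symm
  · simp only [hbc, hda, if_false, Matrix.single_mul_single_of_ne, ne_eq, not_false_eq_true,
      map_zero, LinearMap.zero_apply] at h ⊢
    linear_combination (norm := abel) h.symm

/-- Normal ordering `E₀₁ E₀₀ → E₀₀ E₀₁`. [folklore] -/
theorem c01_00 (x : V) : Φ E₀₁ (Φ E₀₀ x) = Φ E₀₀ (Φ E₀₁ x) - Φ E₀₁ x := by
  simpa using apply_single_apply_single Φ 0 1 0 0 x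

/-- Normal ordering `E₁₀ E₀₀ → E₀₀ E₁₀`. [folklore] -/
theorem c10_00 (x : V) : Φ E₁₀ (Φ E₀₀ x) = Φ E₀₀ (Φ E₁₀ x) + Φ E₁₀ x := by
  simpa using apply_single_apply_single Φ 1 0 0 0 x

/-- Normal ordering `E₁₁ E₀₀ → E₀₀ E₁₁`. [folklore] -/
theorem c11_00 (x : V) : Φ E₁₁ (Φ E₀₀ x) = Φ E₀₀ (Φ E₁₁ x) := by
  simpa using apply_single_apply_single Φ 1 1 0 0 x

/-- Normal ordering `E₁₀ E₀₁ → E₀₁ E₁₀`. [folklore] -/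
theorem c10_01 (x : V) : Φ E₁₀ (Φ E₀₁ x) = Φ E₀₁ (Φ E₁₀ x) + Φ E₁₁ x - Φ E₀₀ x := by
  simpa using apply_single_apply_single Φ 1 0 0 1 x

/-- Normal ordering `E₁₁ E₀₁ → E₀₁ E₁₁`. [folklore] -/
theorem c11_01 (x : V) : Φ E₁₁ (Φ E₀₁ x) = Φ E₀₁ (Φ E₁₁ x) - Φ E₀₁ x := by
  simpa using apply_single_apply_single Φ 1 1 0 1 x

/-- Normal ordering `E₁₁ E₁₀ → E₁₀ E₁₁`. [folklore] -/
theorem c11_10 (x : V) : Φ E₁₁ (Φ E₁₀ x) = Φ E₁₀ (Φ E₁₁ x) + Φ E₁₀ x := by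
  simpa using apply_single_apply_single Φ 1 1 1 0 x

/-- `Φ(1) = Φ(E₀₀) + Φ(E₁₁)` on vectors. [folklore] -/
theorem map_one_apply (x : V) : Φ 1 x = Φ E₀₀ x + Φ E₁₁ x := by
  rw [← Matrix.sum_single_one, Fin.sum_univ_two, map_add, LinearMap.add_apply]

/-- The quadratic Casimir `Σ_{a,b} Φ(E_ab) Φ(E_ba)` on vectors, normally ordered. [folklore] -/
theorem casimir_apply (x : V) :
    (∑ a : Fin 2, ∑ b : Fin 2, Φ (Matrix.single a b 1) * Φ (Matrix.single b a 1)) x =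
      Φ E₀₀ (Φ E₀₀ x) + 2 • Φ E₀₁ (Φ E₁₀ x) + Φ E₁₁ x - Φ E₀₀ x + Φ E₁₁ (Φ E₁₁ x) := by
  simp only [Fin.sum_univ_two, LinearMap.add_apply, Module.End.mul_apply, c10_01]
  abel

end OneAction

section TwoActions

variable (A B : gl₂ →ₗ⁅ℂ⁆ Module.End ℂ V)

-- The composite operators `E, F, P₊, P₋, K₁, K₂, Q₁, Q₂, P₀` as NON-hygienic local notation in
-- whatever `A`, `B` are in scope (the section variables here; the binders of the same names in the
-- two exported `∀`-statements below), so that the helper lemmas apply verbatim inside those proofs.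
set_option hygiene false in
local notation "𝐄" => (A E₀₁ - B E₁₀)
set_option hygiene false in
local notation "𝐅" => (A E₁₀ - B E₀₁)
set_option hygiene false in
local notation "P₊" => (A E₀₁ + B E₁₀)
set_option hygiene false in
local notation "P₋" => (A E₁₀ + B E₀₁)
set_option hygiene false in
local notation "K₁" => (A E₀₀ - B E₀₀)
set_option hygiene false in
local notation "K₂" => (A E₁₁ - B E₁₁)
set_option hygiene false in
local notation "Q₁" => (A E₀₀ + B E₀₀)
set_option hygiene false in
local notation "Q₂" => (A E₁₁ + B E₁₁)
set_option hygiene false in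
local notation "P₀" => (A (E₀₀ - E₁₁) + B (E₀₀ - E₁₁))

/-- Mixed normal ordering for two commuting actions: `B(Y) A(X) x = A(X) B(Y) x`. [folklore] -/
theorem commute_apply (hAB : ∀ X Y : gl₂, A X * B Y = B Y * A X) (X Y : gl₂) (x : V) :
    B Y (A X x) = A X (B Y x) := by
  simpa only [Module.End.mul_apply] using (LinearMap.congr_fun (hAB X Y) x).symm

variable {A B}

/-- `[E, P₊] = 0`. [folklore] -/
theorem e_apply_pPlus (hAB : ∀ X Y : gl₂, A X * B Y = B Y * A X) (x : V) : 𝐄 (P₊ x) = P₊ (𝐄 x) := by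
  simp only [map_add, map_sub, LinearMap.add_apply, LinearMap.sub_apply, commute_apply A B hAB]
  abel

/-- `[K₁, P₊] = P₊`. [folklore] -/
theorem k1_apply_pPlus (hAB : ∀ X Y : gl₂, A X * B Y = B Y * A X) (x : V) :
    K₁ (P₊ x) = P₊ (K₁ x) + P₊ x := by
  simp only [map_add, map_sub, LinearMap.add_apply, LinearMap.sub_apply, c01_00, c10_00,
    commute_apply A B hAB]
  abel

/-- `[K₂, P₊] = -P₊`. [folklore] -/
theorem k2_apply_pPlus (hAB : ∀ X Y : gl₂, A X * B Y = B Y * A X) (x : V) :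
    K₂ (P₊ x) = P₊ (K₂ x) - P₊ x := by
  simp only [map_add, map_sub, LinearMap.add_apply, LinearMap.sub_apply, c11_01, c11_10,
    commute_apply A B hAB]
  abel

/-- `[P₊, F] = P₀`. [folklore] -/
theorem pPlus_apply_f (hAB : ∀ X Y : gl₂, A X * B Y = B Y * A X) (x : V) :
    P₊ (𝐅 x) = 𝐅 (P₊ x) + P₀ x := by
  simp only [map_add, map_sub, LinearMap.add_apply, LinearMap.sub_apply, c10_01, commute_apply A B hAB]
  abel

/-- `[P₀, F] = -2 P₋`. [folklore] -/
theorem pZero_apply_f (hAB : ∀ X Y : gl₂, A X * B Y = B Y * A X) (x : V) :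
    P₀ (𝐅 x) = 𝐅 (P₀ x) - (2 : ℂ) • P₋ x := by
  simp only [map_add, map_sub, LinearMap.add_apply, LinearMap.sub_apply, c01_00, c10_00,
    c11_01, c11_10, commute_apply A B hAB]
  module

/-- `[P₋, P₊] = -(K₁ - K₂)`. [folklore] -/
theorem pMinus_apply_pPlus (hAB : ∀ X Y : gl₂, A X * B Y = B Y * A X) (x : V) :
    P₋ (P₊ x) = P₊ (P₋ x) - (K₁ x - K₂ x) := by
  simp only [map_add, LinearMap.add_apply, LinearMap.sub_apply, c10_01, commute_apply A B hAB]
  abel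

/-- `[E, F] = K₁ - K₂`. [folklore] -/
theorem e_apply_f (hAB : ∀ X Y : gl₂, A X * B Y = B Y * A X) (x : V) :
    𝐄 (𝐅 x) = 𝐅 (𝐄 x) + (K₁ x - K₂ x) := by
  simp only [map_sub, LinearMap.sub_apply, c10_01, commute_apply A B hAB]
  abel

/-- `C_A - C_B = Q₁ K₁ + Q₂ K₂ + P₊ F + P₋ E` (vector form). [folklore] -/
theorem casimir_sub_casimir (hAB : ∀ X Y : gl₂, A X * B Y = B Y * A X) (x : V) :
    (∑ a : Fin 2, ∑ b : Fin 2, A (Matrix.single a b 1) * A (Matrix.single b a 1)) x -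
      (∑ a : Fin 2, ∑ b : Fin 2, B (Matrix.single a b 1) * B (Matrix.single b a 1)) x =
    Q₁ (K₁ x) + Q₂ (K₂ x) + P₊ (𝐅 x) + P₋ (𝐄 x) := by
  simp only [casimir_apply, map_sub, LinearMap.add_apply, LinearMap.sub_apply, c10_01,
    commute_apply A B hAB]
  abel

/-- `(A1+B1)² + P₀² + 2 P₊P₋ + 2 P₋P₊ + 2 C_k = 4 (C_A + C_B)` (vector form). [folklore] -/
theorem casimir_add_casimir (hAB : ∀ X Y : gl₂, A X * B Y = B Y * A X) (x : V) :
    (A 1 + B 1) ((A 1 + B 1) x) + P₀ (P₀ x) + (2 : ℂ) • P₊ (P₋ x) + (2 : ℂ) • P₋ (P₊ x) +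
      (2 : ℂ) • (K₁ (K₁ x) + K₂ (K₂ x) + 𝐄 (𝐅 x) + 𝐅 (𝐄 x)) =
    (4 : ℂ) • ((∑ a : Fin 2, ∑ b : Fin 2, A (Matrix.single a b 1) * A (Matrix.single b a 1)) x +
      (∑ a : Fin 2, ∑ b : Fin 2, B (Matrix.single a b 1) * B (Matrix.single b a 1)) x) := by
  simp only [casimir_apply, map_one_apply, map_add, map_sub, LinearMap.add_apply,
    LinearMap.sub_apply, c11_00, c10_01, commute_apply A B hAB]
  module

/-! ### The level identity and the quartic relation -/

/-- **Level identity** for a `κ`-highest-weight vector `x` (`E x = 0`, `K₁ x = n₁ x`,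
`K₂ x = n₂ x`) of two commuting `𝔤𝔩₂(ℂ)`-actions with scalar centre and Casimirs:
`(n₁ - n₂ + 2) P₀ x = δ x - 2 F P₊ x`, `δ = (2c_A + 1 - S_A²) - (2c_B + 1 - S_B²)`
(evaluate `C_A - C_B = Q₁K₁ + Q₂K₂ + P₊F + P₋E` at `x`). Cf. Knapp (2002), §V.5. [folklore] -/
theorem level_identity :
    ∀ {V : Type} [AddCommGroup V] [Module ℂ V]
      (A B : Matrix (Fin 2) (Fin 2) ℂ →ₗ⁅ℂ⁆ Module.End ℂ V),
      (∀ X Y : Matrix (Fin 2) (Fin 2) ℂ, A X * B Y = B Y * A X) →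
      ∀ (Su Sv cu cv : ℂ),
      A 1 = Su • (1 : Module.End ℂ V) → B 1 = Sv • (1 : Module.End ℂ V) →
      (∑ a : Fin 2, ∑ b : Fin 2, A (Matrix.single a b 1) * A (Matrix.single b a 1)) =
        cu • (1 : Module.End ℂ V) →
      (∑ a : Fin 2, ∑ b : Fin 2, B (Matrix.single a b 1) * B (Matrix.single b a 1)) =
        cv • (1 : Module.End ℂ V) →
      ∀ (x : V) (n₁ n₂ : ℂ),
      (A (Matrix.single 0 1 1) - B (Matrix.single 1 0 1)) x = 0 →
      (A (Matrix.single 0 0 1) - B (Matrix.single 0 0 1)) x = n₁ • x →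
      (A (Matrix.single 1 1 1) - B (Matrix.single 1 1 1)) x = n₂ • x →
      (n₁ - n₂ + 2) • (A (Matrix.single 0 0 1 - Matrix.single 1 1 1) +
          B (Matrix.single 0 0 1 - Matrix.single 1 1 1)) x =
        ((2 * cu + 1 - Su ^ 2) - (2 * cv + 1 - Sv ^ 2)) • x -
          (2 : ℂ) • (A (Matrix.single 1 0 1) - B (Matrix.single 0 1 1))
            ((A (Matrix.single 0 1 1) + B (Matrix.single 1 0 1)) x) := by
  intro V _ _ A B hAB Su Sv cu cv hA1 hB1 hCA hCB x n₁ n₂ hE h1 h2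
  have ha := LinearMap.congr_fun hA1 x
  have hb := LinearMap.congr_fun hB1 x
  rw [map_one_apply] at ha hb
  simp only [LinearMap.smul_apply, Module.End.one_apply] at ha hb
  have hI := casimir_sub_casimir hAB x
  rw [LinearMap.congr_fun hCA x, LinearMap.congr_fun hCB x, h1, h2, hE, map_zero, add_zero,
    pPlus_apply_f hAB x] at hI
  simp only [LinearMap.smul_apply, Module.End.one_apply, map_smul] at hI
  have hQ : Q₁ x + Q₂ x = (Su + Sv) • x := by
    simp only [LinearMap.add_apply]
    linear_combination (norm := module) ha + hb
  have hK : (n₁ + n₂) • x = (Su - Sv) • x := by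
    have h1' := h1
    have h2' := h2
    simp only [LinearMap.sub_apply] at h1' h2'
    linear_combination (norm := module) -h1' - h2' + ha - hb
  have hP0 : P₀ x = Q₁ x - Q₂ x := by
    simp only [map_sub, LinearMap.add_apply, LinearMap.sub_apply]; abel
  rw [hP0] at hI ⊢
  linear_combination (norm := module) (-2 : ℂ) • hI - (n₁ + n₂) • hQ - (Su + Sv) • hK

/-- **The quartic relation for a minimal `U(2)`-type.** Let `A, B : 𝔤𝔩₂(ℂ) → End V` be two
commuting Lie actions with `A(1) = S_A`, `B(1) = S_B`, `Σ A(E_ab)A(E_ba) = c_A`,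
`Σ B(E_ab)B(E_ba) = c_B` scalar, and let `v ≠ 0` be a highest-weight vector for the "compact"
`𝔤𝔩₂`, `κ(Y) = A(Y) - B(Yᵀ)`: `E v = 0`, `K₁ v = m₁ v`, `K₂ v = m₂ v`, with `j = m₁ - m₂` and
`j, j+1, …, j+4 ≠ 0`.  If moreover `P₋ v = (δ/(j(j+2))) F v - (1/((j+1)(j+2))) F² P₊ v`
(the vanishing of the weight-`(j-2)` highest-weight component of `𝔭 ⊗ v`, i.e. minimality of the
`U(2)`-type of `v`), then with `a² := 2c_A + 1 - S_A²`, `a'² := 2c_B + 1 - S_B²`: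
`j⁴ - 2(a² + a'²) j² + (a² - a'²)² = 0`, i.e. `j = ±a ± a'` — the integral pairing of the
Harish-Chandra exponents of the two factors at a complex place. The proof evaluates the two
Casimir identities `C_A ∓ C_B` on `v` and `P₊ v` and eliminates the unknown vector `P₋P₊ v`.
Cf. Jacquet–Langlands (1970), §6; Knapp (1986), Ch. II; Clozel (1990), §3.3. [folklore] -/
theorem quartic_of_minimal :
    ∀ {V : Type} [AddCommGroup V] [Module ℂ V]
      (A B : Matrix (Fin 2) (Fin 2) ℂ →ₗ⁅ℂ⁆ Module.End ℂ V),
      (∀ X Y : Matrix (Fin 2) (Fin 2) ℂ, A X * B Y = B Y * A X) →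
      ∀ (Su Sv cu cv : ℂ),
      A 1 = Su • (1 : Module.End ℂ V) → B 1 = Sv • (1 : Module.End ℂ V) →
      (∑ a : Fin 2, ∑ b : Fin 2, A (Matrix.single a b 1) * A (Matrix.single b a 1)) =
        cu • (1 : Module.End ℂ V) →
      (∑ a : Fin 2, ∑ b : Fin 2, B (Matrix.single a b 1) * B (Matrix.single b a 1)) =
        cv • (1 : Module.End ℂ V) →
      ∀ (v : V) (m₁ m₂ : ℂ), v ≠ 0 →
      (A (Matrix.single 0 1 1) - B (Matrix.single 1 0 1)) v = 0 →
      (A (Matrix.single 0 0 1) - B (Matrix.single 0 0 1)) v = m₁ • v →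
      (A (Matrix.single 1 1 1) - B (Matrix.single 1 1 1)) v = m₂ • v →
      m₁ - m₂ ≠ 0 → m₁ - m₂ + 1 ≠ 0 → m₁ - m₂ + 2 ≠ 0 → m₁ - m₂ + 3 ≠ 0 → m₁ - m₂ + 4 ≠ 0 →
      (A (Matrix.single 1 0 1) + B (Matrix.single 0 1 1)) v =
        (((2 * cu + 1 - Su ^ 2) - (2 * cv + 1 - Sv ^ 2)) / ((m₁ - m₂) * (m₁ - m₂ + 2))) •
            (A (Matrix.single 1 0 1) - B (Matrix.single 0 1 1)) v -
          (1 / ((m₁ - m₂ + 1) * (m₁ - m₂ + 2))) •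
            (A (Matrix.single 1 0 1) - B (Matrix.single 0 1 1))
              ((A (Matrix.single 1 0 1) - B (Matrix.single 0 1 1))
                ((A (Matrix.single 0 1 1) + B (Matrix.single 1 0 1)) v)) →
      (m₁ - m₂) ^ 4 - 2 * ((2 * cu + 1 - Su ^ 2) + (2 * cv + 1 - Sv ^ 2)) * (m₁ - m₂) ^ 2
        + ((2 * cu + 1 - Su ^ 2) - (2 * cv + 1 - Sv ^ 2)) ^ 2 = 0 := by
  intro V _ _ A B hAB Su Sv cu cv hA1 hB1 hCA hCB v m₁ m₂ hv hE h1 h2 hj0 hj1 hj2 _hj3 _hj4 hmin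
  obtain ⟨j, rfl⟩ : ∃ j, m₁ = j + m₂ := ⟨m₁ - m₂, by ring⟩
  simp only [add_sub_cancel_right] at hj0 hj1 hj2 hmin ⊢
  -- the scalar `m₁ + m₂ = Su - Sv`
  have ha := LinearMap.congr_fun hA1 v
  have hb := LinearMap.congr_fun hB1 v
  rw [map_one_apply] at ha hb
  simp only [LinearMap.smul_apply, Module.End.one_apply] at ha hb
  have hsum : j + m₂ + m₂ = Su - Sv := by
    have h1' := h1
    have h2' := h2
    simp only [LinearMap.sub_apply] at h1' h2'
    have h0 : (j + m₂ + m₂ - (Su - Sv)) • v = 0 := by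
      linear_combination (norm := module) -h1' - h2' + ha - hb
    rcases smul_eq_zero.mp h0 with h | h
    · exact sub_eq_zero.mp h
    · exact absurd h hv
  -- weights of `v⁺ = P₊ v`
  have hE' : 𝐄 (P₊ v) = 0 := by rw [e_apply_pPlus hAB, hE, map_zero]
  have h1' : K₁ (P₊ v) = (j + m₂ + 1) • P₊ v := by
    rw [k1_apply_pPlus hAB, h1, map_smul]; module
  have h2' : K₂ (P₊ v) = (m₂ - 1) • P₊ v := by
    rw [k2_apply_pPlus hAB, h2, map_smul]; module
  -- the level identities at `v` and `v⁺`, and their images under `P₀`, `F`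
  have e5 := level_identity A B hAB Su Sv cu cv hA1 hB1 hCA hCB v (j + m₂) m₂ hE h1 h2
  have e6' := level_identity A B hAB Su Sv cu cv hA1 hB1 hCA hCB _ _ _ hE' h1' h2'
  have e6 := congrArg (fun y => 𝐅 y) e6'
  have e7 := congrArg (fun y => P₀ y) e5
  simp only [map_smul, LinearMap.map_sub] at e6 e7
  simp only [add_sub_cancel_right] at e5 e7
  -- commutators
  have e2 : P₊ (𝐅 v) = 𝐅 (P₊ v) + P₀ v := pPlus_apply_f hAB v
  have e3 : P₊ (𝐅 (𝐅 (P₊ v))) = 𝐅 (𝐅 (P₊ (P₊ v))) + 𝐅 (P₀ (P₊ v)) + P₀ (𝐅 (P₊ v)) := by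
    rw [pPlus_apply_f hAB (𝐅 (P₊ v)), pPlus_apply_f hAB (P₊ v), map_add]
  have e4 : P₀ (𝐅 (P₊ v)) = 𝐅 (P₀ (P₊ v)) - (2 : ℂ) • P₋ (P₊ v) := pZero_apply_f hAB (P₊ v)
  have e8 : P₋ (P₊ v) = P₊ (P₋ v) - ((j + m₂) • v - m₂ • v) := by rw [pMinus_apply_pPlus hAB v, h1, h2]
  -- `C_A + C_B` at `v`
  have hQc : A 1 + B 1 = (Su + Sv) • (1 : Module.End ℂ V) := by rw [hA1, hB1, add_smul]
  have e9 : (4 : ℂ) • P₊ (P₋ v) + P₀ (P₀ v) =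
      (4 * (cu + cv) - 2 * (j + m₂) ^ 2 - 2 * m₂ ^ 2 - (Su + Sv) ^ 2) • v := by
    have hI2 := casimir_add_casimir hAB v
    rw [e_apply_f hAB v, pMinus_apply_pPlus hAB v, LinearMap.congr_fun hCA v, LinearMap.congr_fun hCB v,
      hQc] at hI2
    simp only [LinearMap.smul_apply, Module.End.one_apply, h1, h2, hE, map_smul, map_zero,
      add_zero] at hI2
    linear_combination (norm := module) hI2
  -- the minimality relation, denominators cleared, pushed through `P₊`
  have c1 : j * (j + 1) * (j + 2) * (((2 * cu + 1 - Su ^ 2) - (2 * cv + 1 - Sv ^ 2)) /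
      (j * (j + 2))) = (j + 1) * ((2 * cu + 1 - Su ^ 2) - (2 * cv + 1 - Sv ^ 2)) := by
    field_simp
  have c2 : j * (j + 1) * (j + 2) * (1 / ((j + 1) * (j + 2))) = j := by
    field_simp
  have e1 : (j * (j + 1) * (j + 2)) • P₊ (P₋ v) =
      ((j + 1) * ((2 * cu + 1 - Su ^ 2) - (2 * cv + 1 - Sv ^ 2))) • P₊ (𝐅 v) -
        j • P₊ (𝐅 (𝐅 (P₊ v))) := by
    have := congrArg (fun y => (j * (j + 1) * (j + 2)) • P₊ y) hmin
    simp only [map_sub, map_smul, smul_sub, smul_smul] at this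
    rw [this, c1, c2]
  -- elimination
  set δ : ℂ := (2 * cu + 1 - Su ^ 2) - (2 * cv + 1 - Sv ^ 2) with hδ
  set k : ℂ := 4 * (cu + cv) - 2 * (j + m₂) ^ 2 - 2 * m₂ ^ 2 - (Su + Sv) ^ 2 with hk
  clear_value δ k
  have key : ((j + 2) * (4 * j ^ 2 + k * j ^ 2 - δ ^ 2)) • v = 0 := by
    linear_combination (norm := module) (4 : ℂ) • e1 + (4 * (j + 1) * δ) • e2 - (4 * j) • e3 -
      (2 * j * (j + 2)) • e4 + ((j + 2) * δ) • e5 - (2 * j) • e6 + (j ^ 2) • e7 +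
      (4 * j * (j + 2)) • e8 - (j ^ 2 * (j + 2)) • e9
  have hq : 4 * j ^ 2 + k * j ^ 2 - δ ^ 2 = 0 := by
    rcases smul_eq_zero.mp key with h | h
    · exact (mul_eq_zero.mp h).resolve_left hj2
    · exact absurd h hv
  subst hδ hk
  linear_combination (-1 : ℂ) * hq - (j ^ 2 * (Su - Sv + j + 2 * m₂)) * hsum

end TwoActions

end Literature.Algebra.Lie.GL2Pair
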